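import Mathlib
import HarnessLib
import Summits.ValiantsHypothesis.ValiantsHypothesis.Theses.MonotoneRestoration
import Literature.Computability.AlgebraicComplexity.ArithCircuit
import Literature.Computability.AlgebraicComplexity.ArithCircuitProofs
import Literature.Computability.AlgebraicComplexity.MonotoneStructure
import Literature.Computability.AlgebraicComplexity.PermanentIrreducible
import Literature.ModelTheory.FiniteModelTheory.CkEquiv
import Summits.ValiantsHypothesis.ValiantsHypothesis.Theorems.MonotoneRestorationMonotoneRestorationQPCosetCount
import Summits.ValiantsHypothesis.ValiantsHypothesis.Theorems.MonotoneRestorationMonotoneRestorationQPSymmetricLB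
import Summits.ValiantsHypothesis.ValiantsHypothesis.Theorems.MonotoneRestorationMonotoneRestorationQPSupportSymmetrisation
import Summits.ValiantsHypothesis.ValiantsHypothesis.Theorems.MonotoneRestorationMonotoneRestorationQPSparseRegime
import Summits.ValiantsHypothesis.ValiantsHypothesis.Theorems.MonotoneRestorationMonotoneRestorationQPBeta
import Literature.Computability.AlgebraicComplexity.SymmetricArithCircuit
import Literature.Computability.AlgebraicComplexity.DawarWilsenach2025Proofs
import Literature.GroupTheory.PermutationGroups.SmallIndexSubgroups
import Summits.ValiantsHypothesis.ValiantsHypothesis.Theorems.MonotoneRestorationQP.Negative.LoadBearing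
import Summits.ValiantsHypothesis.ValiantsHypothesis.Theorems.MonotoneRestorationMonotoneRestorationQPPermSupportCount

/-! TTRL-lite variant V20179 of stmt-ValiantsHypothesis-15886 -/

-- `Summit.ValiantsHypothesis.ValiantsHypothesis.…` is the tree's mandated single-conjunct layout
-- (Sub = Summit), so the duplicated namespace component is intended.
set_option linter.dupNamespace false

namespace Summit.ValiantsHypothesis.ValiantsHypothesis.Theorems

open Summit.ValiantsHypothesis.ValiantsHypothesis.Theses.MonotoneRestoration
open Literature.Computability.AlgebraicComplexity

/-- **TTRL-lite variant V20179** (`lemma_proposal` of `stub_esymmRowSums_structure`,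
stmt-ValiantsHypothesis-15886): the general principle behind the homogeneity conjunct —
substituting the row sums `R_i = Σ_j x_{i,j}` of the `n × n` variable matrix (each homogeneous
of degree `1`) into ANY homogeneous polynomial `p` of degree `d` over `ℝ≥0` yields a polynomial
homogeneous of degree `d`. Proof: `bind₁ R p = aeval R p`, and `MvPolynomial.IsHomogeneous.aeval`
gives degree `1 * d = d`. [folklore] -/
theorem stub_esymmRowSums_structure_var20179 :
    ∀ (n d : ℕ) (p : MvPolynomial (Fin n) NNReal), p.IsHomogeneous d →
      (MvPolynomial.bind₁ (fun i : Fin n => ∑ j : Fin n,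
        (MvPolynomial.X (i, j) : MvPolynomial (Fin n × Fin n) NNReal)) p).IsHomogeneous d := by
  intro n d p hp
  -- Each row sum is homogeneous of degree `1`.
  have hrow : ∀ i : Fin n, (∑ j : Fin n,
      (MvPolynomial.X (i, j) : MvPolynomial (Fin n × Fin n) NNReal)).IsHomogeneous 1 :=
    fun i => MvPolynomial.IsHomogeneous.sum _ _ _ fun j _ => MvPolynomial.isHomogeneous_X _ _
  -- Substitute: `bind₁ R p = aeval R p` is homogeneous of degree `1 * d`.
  have h := hp.aeval _ hrow
  simpa only [MvPolynomial.aeval_eq_bind₁, one_mul] using h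

end Summit.ValiantsHypothesis.ValiantsHypothesis.Theorems
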